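import Summits.CriticalPhenomena.CardyFormulaZ2.Theorems.CardyComplexConeParafermionToSLESixFamiliesFlipTouchLawDiagAudit
import Summits.CriticalPhenomena.CardyFormulaZ2.Theorems.CardyComplexConeParafermionToSLESixFamiliesFlipTouchDensityBoundary
import Literature.Analysis.Complex.HarmonicSchwarzReflection
import Literature.Analysis.Complex.DerivNeZeroOfHalfDisc
import HarnessLib

/-!
# The covariant touch density EXISTS on flat diagonal free windows (input (0) of `stub_touchLawDiag`)
(line `flip-involution-return-law` of crux `CardyComplexCone.ParafermionToSLESixFamilies`, stmt-CriticalPhenomena-11389;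
second file of input (0), after `…FlipTouchDensityBoundary.lean`)

For a Dobrushin domain `D`, a flat DIAGONAL free window `(m, η, a, b)` (`IsDiagFreeWindow`) and a window
point `y₀ = m + t(iη)`, `|t| < a`:

1. **Chart.** `A ζ = y₀ − iη·ζ` sends the real axis onto the window segment (parameter `t − Re ζ`) and
   `Im ζ > 0` to the inner side (`chart_apply`, `chart_mem_carrier`, `chart_real_boundary`).
2. **Reflection** (`exists_reflected_symm`). For a chordal uniformizer `φ : ℍₒ → D`, `g = φ⁻¹ ∘ A` is
   holomorphic on the upper half of `U = {|Re ζ| < a − |t|, |Im ζ| < b}` with `Im g → 0` at the real points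
   (`tendsto_im_symm_zero`: properness + the boundary values at the marks, which the window avoids); the
   harmonic Schwarz reflection principle of the tree (`exists_differentiableOn_extension_of_tendsto_im`,
   Ahlfors Ch. 4 §6.5 Thm. 26) extends it to `G` holomorphic on `U`, real on the axis; `G′ 0 ≠ 0` by
   conformality at a flat boundary point (`deriv_ne_zero_of_im_lt`: the upper half-disc is mapped strictly
   above the axis) and `G 0 ≠ 0` because `φ⁻¹` is bounded below near `y₀ ≠ a` (`le_norm_symm_near`).
3. **Limit** (`tendsto_touchRatio_of_reflected`). On `D` near `y₀`, `φ⁻¹ = G ∘ A⁻¹`, so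
   `‖(φ⁻¹)′ z / φ⁻¹ z‖^{1/3} → (‖G′ 0‖/‖G 0‖)^{1/3} > 0`.
4. **All uniformizers** (`exists_pos_hasTouchDensityAt_of_isDiagFreeWindow`, registered sub-goal in colon form
   `touchDensity_exists_of_isDiagFreeWindow`): two chordal uniformizers differ by a dilation of `ℍₒ`, so their
   inverses are proportional on `D` (`symm_eq_smul_symm_of_eqOn`) and have the same touch ratio — this uses the
   tree's NAMED, UNPROVED fact `MarkedDomain.IsChordalUniformizing.exists_eq_trans_smul` (Lawler 2005, Ch. 6)
   as an explicit hypothesis; the result is CONDITIONAL on it (and on nothing else).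

So the density `ρ` demanded by `TouchLawPosDiag` exists and is positive at every diagonal window point,
given chordal uniqueness: input (0) of the TOUCH audit is discharged modulo that classical fact.
-/

noncomputable section

namespace Summit.CriticalPhenomena.CardyFormulaZ2.Cruxes.ParafermionToSLESixFamilies.FlipInvolutionReturnLaw

open Filter Set Metric
open scoped Topology
open UpperHalfPlane (upperHalfPlaneSet)
open Literature.Probability.RandomPlanarGeometry
open Summit.CriticalPhenomena.CardyFormulaZ2.Cruxes.ParafermionToSLESixFamilies.IicTraceFluxPairing (tCoord nCoord HasTouchDensityAt)

/-! ## The chart at a diagonal window point and the reflected inverse uniformizer -/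

section Reflection

open Literature.Analysis.Complex (exists_differentiableOn_extension_of_tendsto_im deriv_ne_zero_of_im_lt)

variable {D : DobrushinDomain} {m η : ℂ} {a b : ℝ}

/-- The chart `ζ ↦ y₀ − iη·ζ` at the window point `y₀ = m + t·(iη)`: real `x ↦` the window point of
parameter `t − x`, and `x + is ↦` that point moved by `s` along the inward normal `η`. -/
theorem chart_apply (m η : ℂ) (t x s : ℝ) :
    m + (t : ℂ) * (Complex.I * η) + -(Complex.I * η) * ((x : ℂ) + (s : ℂ) * Complex.I) =
      m + ((t - x : ℝ) : ℂ) * (Complex.I * η) + (s : ℂ) * η := by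
  have hI : Complex.I * Complex.I = -1 := Complex.I_mul_I
  push_cast
  linear_combination (-(η * (s : ℂ))) * hI

/-- A complex number is its real part plus `i` times its imaginary part (in the form the chart uses). -/
theorem re_add_im_mul_I (ζ : ℂ) : ((ζ.re : ℂ) + (ζ.im : ℂ) * Complex.I) = ζ :=
  Complex.re_add_im ζ

/-- Points of the chart rectangle with positive imaginary part land in the carrier. -/
theorem chart_mem_carrier (hW : IsDiagFreeWindow D m η a b) {t : ℝ} {ζ : ℂ}
    (hre : |ζ.re| < a - |t|) (him : 0 < ζ.im) (himb : ζ.im < b) :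
    m + (t : ℂ) * (Complex.I * η) + -(Complex.I * η) * ζ ∈ D.carrier := by
  have h := chart_apply m η t ζ.re ζ.im
  rw [re_add_im_mul_I] at h
  rw [h]
  refine diagWindowPoint_add_mem_carrier hW ?_ him himb
  calc |t - ζ.re| ≤ |t| + |ζ.re| := abs_sub t ζ.re
    _ < a := by linarith

/-- Real points of the chart rectangle land on the window segment: outside the carrier and off the marks. -/
theorem chart_real_boundary (hW : IsDiagFreeWindow D m η a b) {t : ℝ} {x : ℝ} (hx : |x| < a - |t|) :
    m + (t : ℂ) * (Complex.I * η) + -(Complex.I * η) * (x : ℂ) ∉ D.carrier ∧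
      m + (t : ℂ) * (Complex.I * η) + -(Complex.I * η) * (x : ℂ) ≠ D.pt 0 ∧
      m + (t : ℂ) * (Complex.I * η) + -(Complex.I * η) * (x : ℂ) ≠ D.pt 1 := by
  have h := chart_apply m η t x 0
  simp only [Complex.ofReal_zero, zero_mul, add_zero] at h
  rw [h]
  have htx : |t - x| < a := by
    calc |t - x| ≤ |t| + |x| := abs_sub t x
      _ < a := by linarith
  exact ⟨diagWindowPoint_not_mem_carrier hW htx, (diagWindowPoint_mem_arc_and_ne_marks hW htx).2⟩

/-- **Schwarz reflection of the inverse chordal uniformizer across a flat diagonal window.** With the chart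
`A ζ = y₀ − iη ζ` at the window point `y₀ = m + t(iη)` and `U = {|Re ζ| < a − |t|, |Im ζ| < b}`: there is
`G` holomorphic on `U`, equal to `φ⁻¹ ∘ A` on `U ∩ {Im > 0}`, real on `U ∩ ℝ`, with `G 0 ≠ 0` and
`G′ 0 ≠ 0`. -/
theorem exists_reflected_symm (hW : IsDiagFreeWindow D m η a b) {t : ℝ} (ht : |t| < a)
    (φ : ConformalEquiv upperHalfPlaneSet D.carrier) (hφ : D.IsChordalUniformizing φ) :
    ∃ G : ℂ → ℂ, DifferentiableOn ℂ G {ζ : ℂ | |ζ.re| < a - |t| ∧ |ζ.im| < b} ∧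
      EqOn G (fun ζ => φ.symm (m + (t : ℂ) * (Complex.I * η) + -(Complex.I * η) * ζ))
        ({ζ : ℂ | |ζ.re| < a - |t| ∧ |ζ.im| < b} ∩ {ζ | 0 < ζ.im}) ∧
      (G 0).im = 0 ∧ G 0 ≠ 0 ∧ deriv G 0 ≠ 0 := by
  set a' := a - |t| with ha'
  have ha'0 : 0 < a' := by rw [ha']; linarith [abs_nonneg t]
  set U : Set ℂ := {ζ : ℂ | |ζ.re| < a' ∧ |ζ.im| < b} with hUdef
  set A : ℂ → ℂ := fun ζ => m + (t : ℂ) * (Complex.I * η) + -(Complex.I * η) * ζ with hAdef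
  set g : ℂ → ℂ := fun ζ => φ.symm (A ζ) with hgdef
  have hUo : IsOpen U := by
    have h1 : IsOpen {ζ : ℂ | |ζ.re| < a'} := isOpen_lt (continuous_abs.comp Complex.continuous_re) continuous_const
    have h2 : IsOpen {ζ : ℂ | |ζ.im| < b} := isOpen_lt (continuous_abs.comp Complex.continuous_im) continuous_const
    exact h1.inter h2
  have hUsymm : ∀ ζ ∈ U, (starRingEnd ℂ) ζ ∈ U := by
    rintro ζ ⟨h1, h2⟩
    refine ⟨by simpa using h1, ?_⟩
    rw [Complex.conj_im, abs_neg]; exact h2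
  have h0U : (0 : ℂ) ∈ U := ⟨by simp [ha'0], by simp [hW.b_pos]⟩
  have hAcont : Continuous A := by
    simp only [hAdef]; fun_prop
  have hAdiff : Differentiable ℂ A := by
    simp only [hAdef]; fun_prop
  have hAmaps : MapsTo A (U ∩ {ζ | 0 < ζ.im}) D.carrier := by
    rintro ζ ⟨⟨h1, h2⟩, h3⟩
    exact chart_mem_carrier hW h1 h3 (lt_of_abs_lt h2)
  -- holomorphy of `g = ψ ∘ A` above the axis
  have hg : DifferentiableOn ℂ g (U ∩ {ζ | 0 < ζ.im}) :=
    φ.symm.differentiableOn_coe.comp hAdiff.differentiableOn hAmaps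
  -- `Im g → 0` at the real points of `U`
  have hlim : ∀ x ∈ U, x.im = 0 → Tendsto (fun ζ => (g ζ).im) (𝓝[U ∩ {ζ | 0 < ζ.im}] x) (𝓝 0) := by
    intro x hxU hxim
    obtain ⟨hx1, -⟩ := hxU
    have hxeq : x = ((x.re : ℝ) : ℂ) := by
      apply Complex.ext <;> simp [hxim]
    obtain ⟨hnot, h0, h1⟩ := chart_real_boundary hW (t := t) (x := x.re) hx1
    have hAx : A x = m + (t : ℂ) * (Complex.I * η) + -(Complex.I * η) * ((x.re : ℝ) : ℂ) := by
      simp only [hAdef]; rw [← hxeq]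
    have hT := tendsto_im_symm_zero hφ (y := A x) (by rw [hAx]; exact hnot) (by rw [hAx]; exact h1)
    have hA : Tendsto A (𝓝[U ∩ {ζ | 0 < ζ.im}] x) (𝓝[D.carrier] (A x)) :=
      hAcont.continuousWithinAt.tendsto_nhdsWithin hAmaps
    exact hT.comp hA
  obtain ⟨G, hGdiff, hGeq, -, hGreal⟩ := exists_differentiableOn_extension_of_tendsto_im hUo hUsymm hg hlim
  have hG0real : (G 0).im = 0 := hGreal 0 h0U rfl
  have hGa : AnalyticAt ℂ G 0 := hGdiff.analyticAt (hUo.mem_nhds h0U)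
  -- the half-disc of radius `min a' b` at `0` is mapped strictly above the axis
  have him : ∀ ζ : ℂ, ‖ζ‖ < min a' b → 0 < ζ.im → (G 0).im < (G (0 + 1 * ζ)).im := by
    intro ζ hζ hζim
    rw [zero_add, one_mul, hG0real]
    have hζU : ζ ∈ U ∩ {ζ | 0 < ζ.im} := by
      refine ⟨⟨?_, ?_⟩, hζim⟩
      · exact (Complex.abs_re_le_norm ζ).trans_lt (hζ.trans_le (min_le_left _ _))
      · exact (Complex.abs_im_le_norm ζ).trans_lt (hζ.trans_le (min_le_right _ _))
    rw [hGeq hζU]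
    exact symm_mem_upperHalfPlaneSet φ (hAmaps hζU)
  have hderiv : deriv G 0 ≠ 0 := deriv_ne_zero_of_im_lt 1 hGa (lt_min ha'0 hW.b_pos) him
  -- `G 0 ≠ 0`: `ψ` is bounded below near the window point `y₀ = A 0 ≠ pt 0`
  have hA0 : A 0 = m + (t : ℂ) * (Complex.I * η) := by simp [hAdef]
  obtain ⟨-, h00, -⟩ := chart_real_boundary hW (t := t) (x := 0) (by rw [abs_zero]; exact ha'0)
  simp only [Complex.ofReal_zero, mul_zero, add_zero] at h00
  obtain ⟨r, hr, hrle⟩ := le_norm_symm_near hφ (y := A 0) (by rw [hA0]; exact h00)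
  have hA : Tendsto A (𝓝[U ∩ {ζ | 0 < ζ.im}] 0) (𝓝[D.carrier] (A 0)) :=
    hAcont.continuousWithinAt.tendsto_nhdsWithin hAmaps
  have hev : ∀ᶠ ζ in 𝓝[U ∩ {ζ | 0 < ζ.im}] 0, r ≤ ‖G ζ‖ := by
    filter_upwards [hA.eventually hrle, self_mem_nhdsWithin] with ζ hζ hζU
    rw [hGeq hζU]; exact hζ
  have hGcont : Tendsto (fun ζ => ‖G ζ‖) (𝓝[U ∩ {ζ | 0 < ζ.im}] 0) (𝓝 ‖G 0‖) :=
    ((hGa.continuousAt.continuousWithinAt (s := U ∩ {ζ | 0 < ζ.im})).tendsto).norm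
  -- the filter is non-trivial: `0` is in the closure of the upper half of `U`
  haveI : (𝓝[U ∩ {ζ | 0 < ζ.im}] (0 : ℂ)).NeBot := by
    refine mem_closure_iff_nhdsWithin_neBot.1 ?_
    rw [Metric.mem_closure_iff]
    intro ε hε
    refine ⟨((min (ε / 2) (b / 2) : ℝ) : ℂ) * Complex.I, ⟨⟨by simp [ha'0], ?_⟩, ?_⟩, ?_⟩
    · simp only [Complex.mul_im, Complex.ofReal_re, Complex.I_im, mul_one, Complex.ofReal_im,
        Complex.I_re, mul_zero, add_zero]
      rw [abs_of_pos (lt_min (half_pos hε) (half_pos hW.b_pos))]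
      exact (min_le_right _ _).trans_lt (half_lt_self hW.b_pos)
    · show 0 < (((min (ε / 2) (b / 2) : ℝ) : ℂ) * Complex.I).im
      simp only [Complex.mul_im, Complex.ofReal_re, Complex.I_im, mul_one, Complex.ofReal_im,
        Complex.I_re, mul_zero, add_zero]
      exact lt_min (half_pos hε) (half_pos hW.b_pos)
    · rw [dist_zero_left, norm_mul, Complex.norm_I, mul_one, Complex.norm_real, Real.norm_eq_abs,
        abs_of_pos (lt_min (half_pos hε) (half_pos hW.b_pos))]
      exact (min_le_left _ _).trans_lt (half_lt_self hε)
  have hrG : r ≤ ‖G 0‖ := ge_of_tendsto hGcont hev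
  have hG0 : G 0 ≠ 0 := fun h => by rw [h, norm_zero] at hrG; linarith
  exact ⟨G, hGdiff, hGeq, hG0real, hG0, hderiv⟩

/-! ## The touch-density limit for one chordal uniformizer -/

/-- The inverse chart coefficient `c = −iη` is a unit complex number. -/
theorem norm_neg_I_mul_eq_one {η : ℂ} (hη : IsDiagDir η) : ‖-(Complex.I * η)‖ = 1 := by
  rw [norm_neg, norm_mul, Complex.norm_I, one_mul, norm_eq_one_of_isDiagDir hη]

/-- **The touch-density limit for one chordal uniformizer.** With `G` the reflected `φ⁻¹ ∘ A` of
`exists_reflected_symm`: `‖(φ⁻¹)′ z / φ⁻¹ z‖^{1/3} → (‖G′ 0‖/‖G 0‖)^{1/3}` as `z → y₀ = m + t(iη)` inside `D`. -/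
theorem tendsto_touchRatio_of_reflected (hW : IsDiagFreeWindow D m η a b) {t : ℝ} (ht : |t| < a)
    (φ : ConformalEquiv upperHalfPlaneSet D.carrier)
    {G : ℂ → ℂ} (hGdiff : DifferentiableOn ℂ G {ζ : ℂ | |ζ.re| < a - |t| ∧ |ζ.im| < b})
    (hGeq : EqOn G (fun ζ => φ.symm (m + (t : ℂ) * (Complex.I * η) + -(Complex.I * η) * ζ))
        ({ζ : ℂ | |ζ.re| < a - |t| ∧ |ζ.im| < b} ∩ {ζ | 0 < ζ.im}))
    (hG0 : G 0 ≠ 0) :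
    Tendsto (fun z : ℂ => ‖deriv (fun w : ℂ => φ.symm w) z / φ.symm z‖ ^ ((1:ℝ) / 3))
      (𝓝[D.carrier] (m + (t : ℂ) * (Complex.I * η))) (𝓝 ((‖deriv G 0‖ / ‖G 0‖) ^ ((1:ℝ) / 3))) := by
  set a' := a - |t| with ha'
  have ha'0 : 0 < a' := by rw [ha']; linarith [abs_nonneg t]
  set U : Set ℂ := {ζ : ℂ | |ζ.re| < a' ∧ |ζ.im| < b} with hUdef
  set y₀ : ℂ := m + (t : ℂ) * (Complex.I * η) with hy₀
  set c : ℂ := -(Complex.I * η) with hcdef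
  have hc1 : ‖c‖ = 1 := norm_neg_I_mul_eq_one hW.diag
  have hc0 : c ≠ 0 := fun h => by rw [h, norm_zero] at hc1; exact one_ne_zero hc1.symm
  set B : ℂ → ℂ := fun z => c⁻¹ * (z - y₀) with hBdef
  have hAB : ∀ z, y₀ + c * B z = z := fun z => by
    simp only [hBdef]; field_simp; ring
  have hB0 : B y₀ = 0 := by simp [hBdef]
  have hBcont : Continuous B := by simp only [hBdef]; fun_prop
  have hUo : IsOpen U := by
    have h1 : IsOpen {ζ : ℂ | |ζ.re| < a'} := isOpen_lt (continuous_abs.comp Complex.continuous_re) continuous_const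
    have h2 : IsOpen {ζ : ℂ | |ζ.im| < b} := isOpen_lt (continuous_abs.comp Complex.continuous_im) continuous_const
    exact h1.inter h2
  have h0U : (0 : ℂ) ∈ U := ⟨by simp [ha'0], by simp [hW.b_pos]⟩
  -- coordinates of `z = y₀ + c ζ`: tangential `t − Re ζ`, normal `Im ζ`
  have hcoords : ∀ z, tCoord m η z = t - (B z).re ∧ nCoord m η z = (B z).im := by
    intro z
    have h := chart_apply m η t (B z).re (B z).im
    rw [re_add_im_mul_I] at h
    have hz : z = m + ((t - (B z).re : ℝ) : ℂ) * (Complex.I * η) + ((B z).im : ℂ) * η := by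
      rw [← h]; exact (hAB z).symm
    have := coords_diagWindowPoint_add hW.diag m (t - (B z).re) (B z).im
    rw [← hz] at this
    exact this
  -- the good neighbourhood: `z ∈ D` with `B z ∈ U`; there `B z ∈ U ∩ {Im > 0}`
  have hgood : ∀ z ∈ D.carrier, B z ∈ U → B z ∈ U ∩ {ζ | 0 < ζ.im} := by
    intro z hzD hBU
    refine ⟨hBU, ?_⟩
    obtain ⟨h1, h2⟩ := hcoords z
    have htc : |tCoord m η z| < a := by
      rw [h1]
      calc |t - (B z).re| ≤ |t| + |(B z).re| := abs_sub _ _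
        _ < a := by have := hBU.1; rw [ha'] at this; linarith
    have hnc : |nCoord m η z| < b := by rw [h2]; exact hBU.2
    have := (hW.carrier_iff z htc hnc).1 hzD
    show 0 < (B z).im
    rwa [← h2]
  -- `ψ = G ∘ B` on the open set `V = D ∩ B⁻¹ U`
  set V : Set ℂ := D.carrier ∩ B ⁻¹' U with hVdef
  have hVo : IsOpen V := D.isOpen.inter (hUo.preimage hBcont)
  have hψV : EqOn (fun w : ℂ => φ.symm w) (fun w => G (B w)) V := by
    intro z hz
    have hBz := hgood z hz.1 hz.2
    show φ.symm z = G (B z)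
    rw [hGeq hBz]
    show φ.symm z = φ.symm (m + (t : ℂ) * (Complex.I * η) + -(Complex.I * η) * B z)
    rw [show m + (t : ℂ) * (Complex.I * η) + -(Complex.I * η) * B z = y₀ + c * B z from rfl, hAB z]
  -- derivatives on `V`
  have hderivV : ∀ z ∈ V, deriv (fun w : ℂ => φ.symm w) z = deriv G (B z) * c⁻¹ := by
    intro z hz
    have hBz := hgood z hz.1 hz.2
    have hev : (fun w : ℂ => φ.symm w) =ᶠ[𝓝 z] fun w => G (B w) :=
      Filter.eventuallyEq_of_mem (hVo.mem_nhds hz) hψV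
    rw [hev.deriv_eq]
    have hG' : HasDerivAt G (deriv G (B z)) (B z) :=
      ((hGdiff (B z) hBz.1).differentiableAt (hUo.mem_nhds hBz.1)).hasDerivAt
    have hB' : HasDerivAt B (c⁻¹ * 1) z := by
      simp only [hBdef]
      exact ((hasDerivAt_id z).sub_const y₀).const_mul c⁻¹
    rw [mul_one] at hB'
    exact (hG'.comp z hB').deriv
  -- the ratio on `V`
  have hratio : ∀ z ∈ V, ‖deriv (fun w : ℂ => φ.symm w) z / φ.symm z‖ = ‖deriv G (B z)‖ / ‖G (B z)‖ := by
    intro z hz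
    rw [hderivV z hz, show φ.symm z = G (B z) from hψV hz, norm_div, norm_mul, norm_inv, hc1, inv_one, mul_one]
  -- continuity of `G`, `G′` at `0` and the limit
  have hGa : AnalyticAt ℂ G 0 := hGdiff.analyticAt (hUo.mem_nhds h0U)
  have hBt : Tendsto B (𝓝[D.carrier] y₀) (𝓝 0) := by
    rw [← hB0]; exact hBcont.continuousAt.continuousWithinAt.tendsto
  have hlimG : Tendsto (fun z => ‖G (B z)‖) (𝓝[D.carrier] y₀) (𝓝 ‖G 0‖) :=
    (hGa.continuousAt.tendsto.comp hBt).norm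
  have hlimG' : Tendsto (fun z => ‖deriv G (B z)‖) (𝓝[D.carrier] y₀) (𝓝 ‖deriv G 0‖) :=
    (hGa.deriv.continuousAt.tendsto.comp hBt).norm
  have hlim : Tendsto (fun z => ‖deriv G (B z)‖ / ‖G (B z)‖) (𝓝[D.carrier] y₀) (𝓝 (‖deriv G 0‖ / ‖G 0‖)) :=
    hlimG'.div hlimG (norm_ne_zero_iff.2 hG0)
  have hlim3 : Tendsto (fun z => (‖deriv G (B z)‖ / ‖G (B z)‖) ^ ((1:ℝ) / 3)) (𝓝[D.carrier] y₀)
      (𝓝 ((‖deriv G 0‖ / ‖G 0‖) ^ ((1:ℝ) / 3))) :=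
    hlim.rpow_const (Or.inr (by norm_num))
  -- eventually `z ∈ V`
  have hVmem : ∀ᶠ z in 𝓝[D.carrier] y₀, z ∈ V := by
    have h1 : ∀ᶠ z in 𝓝[D.carrier] y₀, B z ∈ U := by
      have : B ⁻¹' U ∈ 𝓝 y₀ := hBcont.continuousAt.preimage_mem_nhds (by rw [hB0]; exact hUo.mem_nhds h0U)
      exact eventually_nhdsWithin_of_eventually_nhds this
    filter_upwards [h1, self_mem_nhdsWithin] with z hz hzD
    exact ⟨hzD, hz⟩
  refine hlim3.congr' ?_
  filter_upwards [hVmem] with z hz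
  rw [hratio z hz]

/-! ## Existence of the touch density on flat diagonal windows (conditional on chordal uniqueness) -/

/-- Two chordal uniformizers related by a dilation have proportional inverses on the carrier. -/
theorem symm_eq_smul_symm_of_eqOn {φ φ' : ConformalEquiv upperHalfPlaneSet D.carrier} {c : ℝ} (hc : 0 < c)
    (h : EqOn φ' ((ConformalEquiv.smulUpperHalfPlane c hc).trans φ) upperHalfPlaneSet) :
    EqOn (fun z : ℂ => φ'.symm z) (fun z => ((c⁻¹ : ℝ) : ℂ) * φ.symm z) D.carrier := by
  intro z hz
  have hw : φ'.symm z ∈ upperHalfPlaneSet := φ'.symm_mapsTo hz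
  have h1 : z = φ (c • φ'.symm z) := by
    have := h hw
    rw [ConformalEquiv.trans_apply, ConformalEquiv.smulUpperHalfPlane_apply] at this
    rw [← this, φ'.apply_symm_apply hz]
  have hcw : c • φ'.symm z ∈ upperHalfPlaneSet := (ConformalEquiv.smulUpperHalfPlane c hc).mapsTo hw
  have h2 : φ.symm z = c • φ'.symm z := by
    conv_lhs => rw [h1]
    exact φ.symm_apply_apply hcw
  show φ'.symm z = ((c⁻¹ : ℝ) : ℂ) * φ.symm z
  rw [h2, Complex.real_smul, ← mul_assoc, ← Complex.ofReal_mul, inv_mul_cancel₀ hc.ne', Complex.ofReal_one, one_mul]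

/-- … hence the same touch ratio `‖(φ⁻¹)′/φ⁻¹‖` on the carrier. -/
theorem touchRatio_eq_of_eqOn {φ φ' : ConformalEquiv upperHalfPlaneSet D.carrier} {c : ℝ} (hc : 0 < c)
    (h : EqOn φ' ((ConformalEquiv.smulUpperHalfPlane c hc).trans φ) upperHalfPlaneSet) {z : ℂ} (hz : z ∈ D.carrier) :
    ‖deriv (fun w : ℂ => φ'.symm w) z / φ'.symm z‖ = ‖deriv (fun w : ℂ => φ.symm w) z / φ.symm z‖ := by
  have hEq := symm_eq_smul_symm_of_eqOn hc h
  have hev : (fun w : ℂ => φ'.symm w) =ᶠ[𝓝 z] fun w => ((c⁻¹ : ℝ) : ℂ) * φ.symm w :=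
    Filter.eventuallyEq_of_mem (D.isOpen.mem_nhds hz) hEq
  rw [hev.deriv_eq, deriv_const_mul_field, show φ'.symm z = ((c⁻¹ : ℝ) : ℂ) * φ.symm z from hEq hz]
  have hc' : ((c⁻¹ : ℝ) : ℂ) ≠ 0 := by exact_mod_cast (inv_pos.2 hc).ne'
  rw [mul_div_mul_left _ _ hc']

/-- **Existence of a positive covariant touch density at every point of a flat diagonal free window**
(input (0) of the stub `stub_touchLawDiag`), CONDITIONAL on the uniqueness of chordal uniformizers up to
dilation (`MarkedDomain.IsChordalUniformizing.exists_eq_trans_smul`, an unproved named fact of the tree):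
by Schwarz reflection of `φ⁻¹` across the window segment, `ρ = (‖G′ 0‖/‖G 0‖)^{1/3} > 0`; the value is
the same for every chordal `φ` since their inverses are proportional. (If `D` had no chordal uniformizer
the density condition would be vacuous.) -/
theorem exists_pos_hasTouchDensityAt_of_isDiagFreeWindow
    (huniq : MarkedDomain.IsChordalUniformizing.exists_eq_trans_smul)
    (hW : IsDiagFreeWindow D m η a b) {t : ℝ} (ht : |t| < a) :
    ∃ ρ : ℝ, 0 < ρ ∧ HasTouchDensityAt D (m + (t : ℂ) * (Complex.I * η)) ρ := by
  by_cases hex : ∃ φ : ConformalEquiv upperHalfPlaneSet D.carrier, D.IsChordalUniformizing φ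
  · obtain ⟨φ, hφ⟩ := hex
    obtain ⟨G, hGdiff, hGeq, -, hG0, hG'0⟩ := exists_reflected_symm hW ht φ hφ
    refine ⟨(‖deriv G 0‖ / ‖G 0‖) ^ ((1:ℝ) / 3), Real.rpow_pos_of_pos (div_pos (norm_pos_iff.2 hG'0) (norm_pos_iff.2 hG0)) _, ?_⟩
    intro φ' hφ'
    obtain ⟨c, hc, hEq⟩ := huniq hφ hφ'
    refine (tendsto_touchRatio_of_reflected hW ht φ hGdiff hGeq hG0).congr' ?_
    filter_upwards [self_mem_nhdsWithin] with z hz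
    rw [touchRatio_eq_of_eqOn hc hEq hz]
  · refine ⟨1, one_pos, ?_⟩
    intro φ' hφ'
    exact absurd ⟨φ', hφ'⟩ hex

/-- **Input (0) of the TOUCH stub, registered form** (sub-goal `touchDensity_exists_of_isDiagFreeWindow` of
stmt-CriticalPhenomena-11389, line `flip-involution-return-law`): conditional on chordal uniqueness up to
dilation, the covariant touch density of `TouchLawPosDiag` exists and is positive at every point of every flat
diagonal free window of every Dobrushin domain. -/
theorem touchDensity_exists_of_isDiagFreeWindow : MarkedDomain.IsChordalUniformizing.exists_eq_trans_smul → ∀ (D : DobrushinDomain) (m η : ℂ) (a b : ℝ), IsDiagFreeWindow D m η a b → ∀ t : ℝ, |t| < a → ∃ ρ : ℝ, 0 < ρ ∧ HasTouchDensityAt D (m + (t : ℂ) * (Complex.I * η)) ρ :=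
  fun huniq _ _ _ _ _ hW _ ht => exists_pos_hasTouchDensityAt_of_isDiagFreeWindow huniq hW ht

end Reflection

end Summit.CriticalPhenomena.CardyFormulaZ2.Cruxes.ParafermionToSLESixFamilies.FlipInvolutionReturnLaw

end
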